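/-
Copyright (c) 2026 the pub-hodgecm-mathlib formalisation cell (harness21).  Prover seat hodgecm-mathlib-LH7-p05 (g2) on the CHAIR K2-lead VALVE,
Track B «K2-LIT» ∕ hLiu418 #184♮ = `stmt-HodgeConjecture-24832`, Road I v3, FACE-G road (E), brick (E-g) «POLYNOMIAL PARTNER» — the SegalBargmann third (E-g-an),
FILE 2 (r02 (F-i) (3): «`v ↦ SW_∞(v)(h)` is continuous»; F4 lead K2Liu-p27 (g2) 23:21:29Z).
THEOREMS ONLY (no `def`, no `instance`, no notation, no named-fact hypothesis, no `sorry`); lane `--supports stmt-HodgeConjecture-24832 --as helper`.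
-/
import Summits.HodgeConjecture.HodgeConjecture.Theorems.K2LiuSWSectionTensorPlaceFactorisation   -- ★ (S4-glob): `swSection_eq_omega_apply_zero`, `exists_omega_rDelta_tmul`,
                                                                                                  --   `exists_omega_cmDoubledWeilRep_tmul`, `apply_zero_piSchwartzBruhatEquiv_tmul`, `swSectionTensor`
import HarnessLib

/-!
# Crux `HLiu418`, FACE-G road (E), brick (E-g), SegalBargmann third — FILE 2: THE SIEGEL–WEIL SECTION OF `Φ_∞ ⊗ f` IS A CONTINUOUS LINEAR FUNCTION OF THE ARCHIMEDEAN
# SCHWARTZ VECTOR `Φ_∞`, for every fixed finite datum `f`, jointly in `h ∈ H(𝔸)` for the product topology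

Cell `hodgecm-mathlib`, crux item hLiu418 = `stmt-HodgeConjecture-24832` (helper lane, count-neutral; closes no socket).  Namespace
`Summit.HodgeConjecture.HodgeConjecture.Cruxes.HLiu418.K2LiuArchSWSectionContinuity`.

WHY (K2E5-r02 (g6) (F-i) step (3), BATCH #131 (1), F4 lead 23:21:29Z).  ★ p863009 `exists_partner_of_tendsto_seq (T : E →L[𝕜] G) …` wants the Siegel–Weil map as a CONTINUOUS
LINEAR map out of `𝓢_∞`.  For ANY `χ`-normalised doubled Weil representation `sD` of ANY doubled datum `(e, dV, dW)` (`χ` unitary, `χ|_{𝕀_{L⁺}} = ε`) and every finite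
Schwartz–Bruhat vector `f`, the map `Φ_∞ ↦ (g ↦ swSection sD (E(Φ_∞ ⊗ f)) g)` IS such a map into `H(𝔸) → ℂ` (product topology — a Hausdorff TVS, ★ p863009's `G`):
`swSection sD Φ g = (ω(rDelta · sD g) Φ)(0)` (★ `swSection_eq_omega_apply_zero`), `ω(sD g)(Φ_∞ ⊗ f) = A_{g_∞} Φ_∞ ⊗ Ω(g_f) f` with a continuous linear `A_{g_∞}`
(★ `exists_omega_cmDoubledWeilRep_tmul`, after ★ uniqueness `eq_cmDoubledWeilRep_of_isDoubledWeilRep`), `ω(rDelta)(Ψ ⊗ f′) = A′Ψ ⊗ M f′` with `A′` a topological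
automorphism (★ `exists_omega_rDelta_tmul`), and `E(Ψ ⊗ f″)(0) = Ψ(0) · f″(0)` (★ `apply_zero_piSchwartzBruhatEquiv_tmul`) — so per `g` the value is
`c_g · δ₀(A′(A_{g_∞} Φ_∞))` with the point evaluation `evalCLM 0 ∘ toBoundedContinuousFunctionCLM` (a CLM, Mathlib), and `ContinuousLinearMap.pi` glues over `g`.
* §1 `exists_clm_swSection_tmul` — `∃ T : 𝓢((L⁺ ⊗ ℝ)^{n+n}) →L[ℂ] (H(𝔸) → ℂ), ∀ Φ_∞ g, T Φ_∞ g = swSection sD (E(Φ_∞ ⊗ f)) g`.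
* §2 `exists_clm_swSectionTensor_tmul` — the same for #42F′'s `swSectionTensor sB` of the BIG datum `(e′, dV, dW ⊗ dV′)` read on `U(𝔻)(𝔸)` through ★ `tensorEmb`
  (`swSectionTensor sB Φ h = swSection(big) sB Φ (h ⊗ 1)`): `∃ T : 𝓢_∞ →L[ℂ] (H(𝔸) → ℂ), ∀ v h, T v h = swSectionTensor … sB (E(v ⊗ f)) h` — ★ p863009's `T`, and
  `continuous_swSectionTensor_tmul_left` (the scalar form at fixed `h`).
NOT HERE: the `genFamily` ∕ `stdExtension` twist (a pointwise multiplication by `d(h) · height(h)^{…}`, linear in the section — the (E-g) head assembler applies it to `T`).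
References: [Weil1964, Chap. III n° 37–40 pp. 188–191]; [KudlaRallis1994, §1]; [HarrisKudlaSweet1996, §1 (1.15)–(1.16)]; [Kudla1996, Chap. I §6 Lemma 6.3]; [Rudin1991, Thm. 1.21].
HONEST LABEL: HC_CM is proved only modulo the 7 printed citations (2 remaining named inputs: hLiu418 = stmt-HodgeConjecture-24832, h413 = stmt-HodgeConjecture-24833) until
rung 0 closes; count-neutral helper (`--supports stmt-HodgeConjecture-24832 --as helper`), closes no socket, moves no counter.
-/

set_option autoImplicit false
set_option linter.dupNamespace false -- the mandated namespace repeats `HodgeConjecture.HodgeConjecture`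

noncomputable section

open scoped Matrix TensorProduct Classical
open NumberField NumberField.mixedEmbedding IsDedekindDomain Filter
open Literature.NumberTheory.Automorphic Literature.NumberTheory.Automorphic.UnitaryGroup Literature.NumberTheory.GaloisRepresentations
open Literature.NumberTheory.Weil1964 Literature.RepresentationTheory.HarrisKudlaSweet1996 Literature.RepresentationTheory.HeisenbergGroup
open Literature.NumberTheory.GelbartRogawski1991 Literature.NumberTheory.GelbartRogawski1991.GRConstruction
open Literature.NumberTheory.GelbartRogawski1991.UnitaryDualPair.LocalSplitting
open Literature.NumberTheory.K2Lit.SiegelDoubled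
open Summit.HodgeConjecture.HodgeConjecture.Cruxes.HLiu418.K2LiuSWSectionPlaceFactorisation

namespace Summit.HodgeConjecture.HodgeConjecture.Cruxes.HLiu418.K2LiuArchSWSectionContinuity

variable (L : Type) [Field L] [NumberField L] [IsCMField L]
variable {N M n : ℕ} (e : Fin N × Fin M ≃ Fin n)
  (dV : Fin N → L) (hdV : ∀ i, IsCMField.complexConj L (dV i) = dV i) (hdV0 : ∀ i, dV i ≠ 0)
  (dW : Fin M → L) (hdW : ∀ i, IsCMField.complexConj L (dW i) = dW i) (hdW0 : ∀ i, dW i ≠ 0)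

/-! ## §1 Any doubled datum: `Φ_∞ ↦ (g ↦ swSection sD (E(Φ_∞ ⊗ f)) g)` is a continuous linear map into `H(𝔸) → ℂ` -/

/-- **THE SIEGEL–WEIL SECTION OF A PURE TENSOR IS CONTINUOUS LINEAR IN THE ARCHIMEDEAN VECTOR.**  For ANY `χ`-normalised doubled Weil representation `sD`
(`IsDoubledWeilRep χ sD`, `χ` unitary with `χ|_{𝕀_{L⁺}} = ε`) and every finite Schwartz–Bruhat vector `f`: there is a continuous linear
`T : 𝓢((L⁺ ⊗ ℝ)^{n+n}, ℂ) →L[ℂ] (H(𝔸) → ℂ)` (product topology) with `T Φ_∞ g = swSection sD (E(Φ_∞ ⊗ f)) g` for all `Φ_∞, g` — per `g` the value is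
`(M(Ω(g_f) f))(0) · δ₀(A′(A_{g_∞} Φ_∞))` (★ uniqueness `eq_cmDoubledWeilRep_of_isDoubledWeilRep`, ★ `exists_omega_cmDoubledWeilRep_tmul`, ★ `exists_omega_rDelta_tmul`,
★ `swSection_eq_omega_apply_zero`, ★ `apply_zero_piSchwartzBruhatEquiv_tmul`, Mathlib `BoundedContinuousFunction.evalCLM` ∘ `SchwartzMap.toBoundedContinuousFunctionCLM`). [cite: Weil1964, Chap. III n° 37–40 pp. 188–191]
[cite: KudlaRallis1994, §1] [cite: Kudla1996, Chap. I §6 Lemma 6.3] [cite: Rudin1991, Thm. 1.21] -/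
theorem exists_clm_swSection_tmul {χ : HeckeCharacter L} (hχu : χ.IsUnitary) (hχs : IsSplittingChar L 1 χ)
    {sD : HA L e dV hdV dW hdW →* MpD L e dV hdV dW hdW} (hsD : IsDoubledWeilRep L e dV hdV hdV0 dW hdW hdW0 χ sD)
    (f : FinSB (Fp L) (Fin (n + n))) :
    ∃ T : SchwartzMap (Fin (n + n) → mixedSpace (Fp L)) ℂ →L[ℂ] (HA L e dV hdV dW hdW → ℂ),
      ∀ (Φinf : SchwartzMap (Fin (n + n) → mixedSpace (Fp L)) ℂ) (g : HA L e dV hdV dW hdW),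
        T Φinf g = swSection L e dV hdV hdV0 dW hdW hdW0 sD (piSchwartzBruhatEquiv (Fp L) (Fin (n + n)) (Φinf ⊗ₜ f)) g := by
  -- `sD` IS the explicit representation for SOME archimedean half (★ uniqueness)
  have ha := Classical.choose_spec (exists_isArchHalf L e dV hdV hdV0 dW hdW hdW0 χ hχu hχs)
  have hs := eq_cmDoubledWeilRep_of_isDoubledWeilRep L e dV hdV hdV0 dW hdW hdW0 χ hχs (borelPlaceMeasure L) ha hsD
  -- the archimedean operators `A_{g}` of `ω(s^𝔻 g)` and `A′` of `ω(rDelta)` on pure tensors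
  choose A hA using fun g : HA L e dV hdV dW hdW =>
    exists_omega_cmDoubledWeilRep_tmul L e dV hdV hdV0 dW hdW hdW0 χ hχs (borelPlaceMeasure L) ha g
  obtain ⟨A', hA'⟩ := exists_omega_rDelta_tmul L e dV hdV hdV0 dW hdW hdW0 χ (borelPlaceMeasure L)
    (cmFinLocalFamily L e dV hdV hdV0 dW hdW hdW0 χ hχs (borelPlaceMeasure L))
  refine ⟨ContinuousLinearMap.pi fun g : HA L e dV hdV dW hdW =>
      (((piEquiv (deltaImpl L e dV hdV hdV0 dW hdW hdW0 χ (borelPlaceMeasure L) (cmFinLocalFamily L e dV hdV hdV0 dW hdW hdW0 χ hχs (borelPlaceMeasure L)))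
            (eventually_deltaImpl_unitVec L e dV hdV hdV0 dW hdW hdW0 χ (borelPlaceMeasure L)
              (cmFinLocalFamily L e dV hdV hdV0 dW hdW hdW0 χ hχs (borelPlaceMeasure L)))
            ((finSplittings L e dV hdV hdV0 dW hdW hdW0 χ (borelPlaceMeasure L) (cmFinLocalFamily L e dV hdV hdV0 dW hdW hdW0 χ hχs (borelPlaceMeasure L))).Omega
              (UnitaryGroup.finPart (Fp L) L (IsCMField.complexConj L) (n + n) (hermD L e dV hdV dW hdW) g) f) : FinSB (Fp L) (Fin (n + n))) :
          (Fin (n + n) → FiniteAdeleRing (𝓞 (Fp L)) (Fp L)) → ℂ) 0) •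
        (((BoundedContinuousFunction.evalCLM ℂ (0 : Fin (n + n) → mixedSpace (Fp L))).comp
            (SchwartzMap.toBoundedContinuousFunctionCLM ℂ (Fin (n + n) → mixedSpace (Fp L)) ℂ)).comp
          ((A' : SchwartzMap (Fin (n + n) → mixedSpace (Fp L)) ℂ →L[ℂ] SchwartzMap (Fin (n + n) → mixedSpace (Fp L)) ℂ).comp (A g))),
    fun Φinf g => ?_⟩
  -- NB: no goal-level `rw` against `ω(·)` on the doubled carriers (keyed abstraction over `DFunLike.coe` times out at `whnf`); term-mode chain.
  -- `ω(rDelta · s g)(Φ ⊗ f) = ω(rDelta)(ω(s g)(Φ ⊗ f)) = ω(rDelta)(A_g Φ ⊗ Ω f) = A′(A_g Φ) ⊗ M(Ω f)`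
  have h1 : adelicMpCont.omega (Fp L) (Fin (n + n)) (gramDA L e dV hdV dW hdW) (sD g) (piSchwartzBruhatEquiv (Fp L) (Fin (n + n)) (Φinf ⊗ₜ f)) =
      piSchwartzBruhatEquiv (Fp L) (Fin (n + n)) (A g Φinf ⊗ₜ
        (finSplittings L e dV hdV hdV0 dW hdW hdW0 χ (borelPlaceMeasure L) (cmFinLocalFamily L e dV hdV hdV0 dW hdW hdW0 χ hχs (borelPlaceMeasure L))).Omega
          (UnitaryGroup.finPart (Fp L) L (IsCMField.complexConj L) (n + n) (hermD L e dV hdV dW hdW) g) f) :=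
    (congrArg (fun s : HA L e dV hdV dW hdW →* MpD L e dV hdV dW hdW => adelicMpCont.omega (Fp L) (Fin (n + n)) (gramDA L e dV hdV dW hdW) (s g)
      (piSchwartzBruhatEquiv (Fp L) (Fin (n + n)) (Φinf ⊗ₜ f))) hs).trans (hA g Φinf f)
  have h2 := (LinearMap.congr_fun (map_mul (adelicMpCont.omega (Fp L) (Fin (n + n)) (gramDA L e dV hdV dW hdW))
      (rDelta L e dV hdV hdV0 dW hdW hdW0) (sD g)) (piSchwartzBruhatEquiv (Fp L) (Fin (n + n)) (Φinf ⊗ₜ f))).trans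
    ((congrArg (adelicMpCont.omega (Fp L) (Fin (n + n)) (gramDA L e dV hdV dW hdW) (rDelta L e dV hdV hdV0 dW hdW hdW0)) h1).trans (hA' _ _))
  -- read at `0`
  have h3 := (swSection_eq_omega_apply_zero L e dV hdV hdV0 dW hdW hdW0 sD (piSchwartzBruhatEquiv (Fp L) (Fin (n + n)) (Φinf ⊗ₜ f)) g).trans
    ((congrArg (fun Ψ : ↥(piSchwartzBruhat (Fp L) (Fin (n + n))) => (Ψ : (Fin (n + n) → AdeleRing (𝓞 (Fp L)) (Fp L)) → ℂ) 0) h2).trans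
      (apply_zero_piSchwartzBruhatEquiv_tmul (Fp L) (Fin (n + n)) _ _))
  rw [h3]
  simp only [ContinuousLinearMap.pi_apply, _root_.smul_apply, ContinuousLinearMap.comp_apply, ContinuousLinearEquiv.coe_coe,
    BoundedContinuousFunction.evalCLM_apply, SchwartzMap.toBoundedContinuousFunctionCLM_apply, smul_eq_mul, mul_comm]

/-! ## §2 The #42F′ instance: `swSectionTensor` of the BIG datum read through `tensorEmb` -/

section Tensor

variable {M₂ M' n' : ℕ} (eW : Fin M × Fin M₂ ≃ Fin M') (e' : Fin N × Fin M' ≃ Fin n')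
  (dV' : Fin M₂ → L) (hdV' : ∀ k, IsCMField.complexConj L (dV' k) = dV' k) (hdV'0 : ∀ k, dV' k ≠ 0)

include hdW0 hdV'0 in
/-- **★ p863009's `T` FOR #42F′**: for ANY `χ`-normalised doubled Weil representation `sB` of the BIG datum `(e′, dV, dW ⊗ dV′)` and every finite datum `f`, there is
`T : 𝓢((L⁺ ⊗ ℝ)^{n′+n′}, ℂ) →L[ℂ] (U(𝔻)(𝔸) → ℂ)` with `T v h = swSectionTensor sB (E(v ⊗ f)) h` (§1 at the big datum, composed with evaluation at `h ⊗ 1 = tensorEmb h`).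
[cite: Weil1964, Chap. III n° 37–40 pp. 188–191] [cite: KudlaRallis1994, §1] [cite: Rudin1991, Thm. 1.21] -/
theorem exists_clm_swSectionTensor_tmul {χ : HeckeCharacter L} (hχu : χ.IsUnitary) (hχs : IsSplittingChar L 1 χ)
    {sB : HA L e' dV hdV (tensorFrame L dW eW dV') (tensorFrame_real L dW hdW eW dV' hdV') →*
      MpD L e' dV hdV (tensorFrame L dW eW dV') (tensorFrame_real L dW hdW eW dV' hdV')}
    (hsB : IsDoubledWeilRep L e' dV hdV hdV0 (tensorFrame L dW eW dV') (tensorFrame_real L dW hdW eW dV' hdV')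
      (tensorFrame_ne_zero L dW eW dV' hdW0 hdV'0) χ sB)
    (f : FinSB (Fp L) (Fin (n' + n'))) :
    ∃ T : SchwartzMap (Fin (n' + n') → mixedSpace (Fp L)) ℂ →L[ℂ] (HA L e dV hdV dW hdW → ℂ),
      ∀ (v : SchwartzMap (Fin (n' + n') → mixedSpace (Fp L)) ℂ) (h : HA L e dV hdV dW hdW),
        T v h = swSectionTensor L e dV hdV dW hdW eW e' dV' hdV' hdV0 hdW0 hdV'0 sB (piSchwartzBruhatEquiv (Fp L) (Fin (n' + n')) (v ⊗ₜ f)) h := by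
  obtain ⟨T, hT⟩ := exists_clm_swSection_tmul L e' dV hdV hdV0 (tensorFrame L dW eW dV') (tensorFrame_real L dW hdW eW dV' hdV')
    (tensorFrame_ne_zero L dW eW dV' hdW0 hdV'0) hχu hχs hsB f
  refine ⟨ContinuousLinearMap.pi fun h : HA L e dV hdV dW hdW =>
      (ContinuousLinearMap.proj (R := ℂ) (tensorEmb L e dV hdV dW hdW eW e' dV' hdV' h)).comp T, fun v h => ?_⟩
  rw [ContinuousLinearMap.pi_apply, ContinuousLinearMap.comp_apply, ContinuousLinearMap.proj_apply, hT]
  rfl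

include hdW0 hdV'0 in
/-- the scalar form: for fixed `f` and `h`, `v ↦ swSectionTensor sB (E(v ⊗ f)) h` is CONTINUOUS (and linear) on `𝓢_∞`. [cite: Weil1964, Chap. III n° 38 pp. 188–189]
[cite: KudlaRallis1994, §1] -/
theorem continuous_swSectionTensor_tmul_left {χ : HeckeCharacter L} (hχu : χ.IsUnitary) (hχs : IsSplittingChar L 1 χ)
    {sB : HA L e' dV hdV (tensorFrame L dW eW dV') (tensorFrame_real L dW hdW eW dV' hdV') →*
      MpD L e' dV hdV (tensorFrame L dW eW dV') (tensorFrame_real L dW hdW eW dV' hdV')}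
    (hsB : IsDoubledWeilRep L e' dV hdV hdV0 (tensorFrame L dW eW dV') (tensorFrame_real L dW hdW eW dV' hdV')
      (tensorFrame_ne_zero L dW eW dV' hdW0 hdV'0) χ sB)
    (f : FinSB (Fp L) (Fin (n' + n'))) (h : HA L e dV hdV dW hdW) :
    Continuous fun v : SchwartzMap (Fin (n' + n') → mixedSpace (Fp L)) ℂ =>
      swSectionTensor L e dV hdV dW hdW eW e' dV' hdV' hdV0 hdW0 hdV'0 sB (piSchwartzBruhatEquiv (Fp L) (Fin (n' + n')) (v ⊗ₜ f)) h := by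
  obtain ⟨T, hT⟩ := exists_clm_swSectionTensor_tmul L e dV hdV hdV0 dW hdW hdW0 eW e' dV' hdV' hdV'0 hχu hχs hsB f
  have hfun : (fun v : SchwartzMap (Fin (n' + n') → mixedSpace (Fp L)) ℂ =>
      swSectionTensor L e dV hdV dW hdW eW e' dV' hdV' hdV0 hdW0 hdV'0 sB (piSchwartzBruhatEquiv (Fp L) (Fin (n' + n')) (v ⊗ₜ f)) h) =
      fun v => T v h := funext fun v => (hT v h).symm
  rw [hfun]
  exact (continuous_apply h).comp T.continuous

end Tensor

end Summit.HodgeConjecture.HodgeConjecture.Cruxes.HLiu418.K2LiuArchSWSectionContinuity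

end
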